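import Summits.KontsevichZagierPeriods.Zeta5Search.Barrier.ConeGammaFarSlice
import Summits.KontsevichZagierPeriods.Zeta5Search.Barrier.ConeGammaEnvelopeCheck
import Summits.KontsevichZagierPeriods.Zeta5Search.Barrier.ConeGammaCritFar

/-!
# ζ(5) search — BARRIER: `C₀` TO FIRST ORDER IN THE FAR CHART — the computable centre-slice checker

HONEST FRAMING (cell `pub-zeta5`): systematic search; no irrationality claim unless kernel-certified. Computable integer /
`MI` / `ℚ` DATA and FUNCTIONS only (none Prop-valued, no named fact); soundness is `ConeGammaFarSliceSound`. Objects: cert-2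
g39's value function `Envelope.valueV` in cert-2 g38's far chart (`FarSlice.valA`, `valH`, `valK`); MODEL objects under BZ
(28)+(30). Nothing about any γ of record, C2 (OPEN), S-E or `ζ(5)`. Theory seat cert-2 g40 (item «C₀ TO FIRST ORDER IN THE
FAR CHART — THE CENTRE-SLICE CERTIFICATE», part 2).

DATA CONVENTIONS (cert-2 g36/g37/g38/g39): direction box `lo_i ≤ D·t_i ≤ hi_i` (`t₀ = 1`), `Q = 2·D·T`; the fixed slice
abscissa `X_c = xc/Q`; cert-2 g38's far interval `Z = [zlo, zhi]/zden` (`FarData`) cut at the breakpoints `zcuts` into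
z-PIECES (no piece straddles `0`); all logarithms by the tree's `MI.logNat2` at scale `SC = 2^60` (`lnNat`).
* `kRange`, `kFormLogI`, `kAcc` — for the eight `Y`-forms `β′ + z·m(s, X_c)`: exact integer range of `Q·zden·(β′ + z m)` over
  box × `Z`, the interval `∋ log|β′ + z m|`, and the HULL accumulator of the resolved secants (g36's `addHull`);
* `aHull` — g39's `envAcc` on the thirteen `Y`-free forms with the degenerate tube `{X_c}`;
* `xlnxI`, `hAt`, `etaAt`, `lamPiece`, `quadNonnegOn`, `kPieceLo`, `kMin` — `K_c(X_c, ·)` on `Z` from below, piece by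
  piece (second-order models of `H` from g39's per-form quadratic bounds, verified exactly as quadratic sign conditions;
  `H(0) = H′(0) = 0` serves the pieces touching `0`); `aCentre` — `A_c(X_c)` as an interval;
* `xRange` — the `X`-range of the far point on a z-piece (g38's `xhatAF` on `coordAF` data); `cellRho`, `concCell`,
  `concPiece` — the per-form curvature weights of the two-point tangent inequality in `X` on (X-sub-piece × z-piece) cells
  (the six `X`-forms by integer ranges at scale `Q·M`, the two mixed forms `X+Y`, `X+Y+s₆−s₀` by `Y = 1/z` ranges in `ℚ`,
  unbounded ends allowed) and the sign conditions;
* `sliceHull`, **`farSliceCheck`** — the assembled check and the hull `hull_A + hull_K` (8 intervals at scale `SC`).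
-/

namespace Summit.KontsevichZagierPeriods.Zeta5Search.Barrier.ConeGamma

namespace FarSlice

open Literature.Analysis.ValidatedNumerics (AForm)
open Literature.Analysis.ValidatedNumerics.NumericsMP
open LemmaFBox (SC coef minNum maxNum sum8 lnNat)
open LemmaFWinBox (getI addHull zeroHull)
open Envelope (EForm Tube vforms envAcc rangeLo rangeHi)
open CritFar (FarData zAbsMax xhatAF)
open CritBox (tAF coordAF boxOKc)

/-! ### Data -/

/-- Certificate data of the centre slice: the slice abscissa `X_c = xc/Q`, the interior z-breakpoints (scale `fd.zden`,
strictly increasing, strictly inside `(zlo, zhi)`, containing `0` if `Z ∋ 0`), the number of `X`-sub-pieces per z-piece,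
and the claimed constant `C₀⁰ = c0num/den`. -/
structure SliceData where
  /-- `Q·X_c` -/
  xc : ℤ
  /-- interior breakpoints of `Z` at scale `zden` -/
  zcuts : List ℤ
  /-- number of `X`-sub-pieces per z-piece (`≥ 1`) -/
  xsub : ℕ
  /-- claimed `C₀⁰` numerator (denominator `den`) -/
  c0num : ℤ
  /-- denominator of `C₀⁰` -/
  den : ℕ
  deriving DecidableEq, Repr

/-- The breakpoint list `zlo :: zcuts ++ [zhi]`. -/
def zList (fd : FarData) (sd : SliceData) : List ℤ := fd.zlo :: sd.zcuts ++ [fd.zhi]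

/-- Strictly increasing list of integers, no consecutive pair straddling `0`. -/
def zListOK : List ℤ → Bool
  | [] => true
  | [_] => true
  | a :: b :: l => decide (a < b) && !(decide (a < 0) && decide (0 < b)) && zListOK (b :: l)

/-- The consecutive pairs of a list. -/
def pairs : List ℤ → List (ℤ × ℤ)
  | [] => []
  | [_] => []
  | a :: b :: l => (a, b) :: pairs (b :: l)

/-- The last element of a non-empty breakpoint list. -/
def zLast : List ℤ → ℤ
  | [] => 0
  | [a] => a
  | _ :: b :: l => zLast (b :: l)

/-! ### The resolved `Y`-forms over box × `Z` at `X_c`: ranges, logarithms, hull -/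

/-- Exact range `[mlo, mhi]` of `Q·m(s, X_c)` over the box (`m = α·s + β·X_c`). -/
def mRange (T : ℕ) (lo hi : List ℕ) (xc : ℤ) (f : KForm) : ℤ × ℤ :=
  (2 * (T : ℤ) * minNum f.al lo hi + f.bx * xc, 2 * (T : ℤ) * maxNum f.al lo hi + f.bx * xc)

/-- Exact range of `Q·zden·(β′ + z·m)` over box × `[za, zb]/zden` (corners of the bilinear `zN·(Q m)`). -/
def kRange (Q T : ℕ) (lo hi : List ℕ) (xc : ℤ) (zden : ℕ) (za zb : ℤ) (f : KForm) : ℤ × ℤ :=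
  let mm := mRange T lo hi xc f
  let c1 := za * mm.1
  let c2 := za * mm.2
  let c3 := zb * mm.1
  let c4 := zb * mm.2
  let b : ℤ := (Q : ℤ) * zden * f.bp
  (b + min (min c1 c2) (min c3 c4), b + max (max c1 c2) (max c3 c4))

/-- Modulus range `(m, M)` of `Q·zden·(β′ + z·m)` if the resolved form keeps a strict sign on box × piece (`(0, 0)` otherwise). -/
def kModRange (Q T : ℕ) (lo hi : List ℕ) (xc : ℤ) (zden : ℕ) (za zb : ℤ) (f : KForm) : ℤ × ℤ :=
  let A := (kRange Q T lo hi xc zden za zb f).1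
  let B := (kRange Q T lo hi xc zden za zb f).2
  if 0 < A then (A, B) else if B < 0 then (-B, -A) else (0, 0)

/-- The interval `∋ log|β′ + z·m|` over box × `[za, zb]/zden` (`none` if the form is not sign-definite or a log fails). -/
def kFormLogI (Q T : ℕ) (lo hi : List ℕ) (xc : ℤ) (zden : ℕ) (za zb : ℤ) (f : KForm) : Option MI :=
  let mM := kModRange Q T lo hi xc zden za zb f
  if mM.1 ≤ 0 ∨ mM.2 < mM.1 then none else
    match lnNat mM.1.toNat, lnNat mM.2.toNat, lnNat (Q * zden) with
    | some Lm, some LM, some LQ => some ((MI.span Lm LM).sub LQ)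
    | _, _, _ => none

/-- HULL accumulator of the resolved secants: `g` with «∀ z ∈ Z ∀ t ∈ box ∃ v ∈ g, K_t(X_c, z) − K_c(X_c, z) = Σ (t_i − c_i)·v_i». -/
def kAcc (Q T : ℕ) (lo hi : List ℕ) (xc : ℤ) (zden : ℕ) (za zb : ℤ) : List KForm → Option (List MI)
  | [] => some zeroHull
  | f :: F =>
    match kAcc Q T lo hi xc zden za zb F, kFormLogI Q T lo hi xc zden za zb f with
    | some g, some I => some (addHull g I f.sg f.al)
    | _, _ => none

/-- The hull of the thirteen `Y`-free forms at the fixed abscissa (g39's `envAcc` with the degenerate tube `{X_c}`). -/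
def aHull (D T : ℕ) (lo hi : List ℕ) (xc : ℤ) : Option (List MI) :=
  match envAcc D T lo hi ⟨xc, xc, 0, 0⟩ 0 0 aforms with
  | some (g, _) => some g
  | none => none

/-- Coordinate-wise sum of two hulls. -/
def addHulls (g h : List MI) : List MI := (List.range 8).map fun i => (getI g i).add (getI h i)

/-! ### `K_c(X_c, ·)` from below on `Z`, piece by piece -/

/-- `xlnx(w/N) = (w/N)(log|w| − log N) − w/N` as an interval at scale `SC` (`none` if `w = 0` or a log fails). -/
def xlnxI (w : ℤ) (N : ℕ) : Option MI :=
  if w = 0 then none else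
    match lnNat w.natAbs, lnNat N with
    | some Lw, some LN => some ((((Lw.sub LN).mulInt w).divNat N).sub (MI.ofFrac SC w N))
    | _, _ => none

/-- `Q·m_k(c, X_c)` at the box centre: `T·(minNum + maxNum) + β·xc`. -/
def mcN (T : ℕ) (lo hi : List ℕ) (xc : ℤ) (f : KForm) : ℤ := (T : ℤ) * (minNum f.al lo hi + maxNum f.al lo hi) + f.bx * xc

/-- `w_k(zN) = Q·zden·β′_k + zN·(Q·m_k(c, X_c)) = Q·zden·(β′_k + z·m_k)` at `z = zN/zden`. -/
def wAt (Q T : ℕ) (lo hi : List ℕ) (xc : ℤ) (zden : ℕ) (zN : ℤ) (f : KForm) : ℤ :=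
  (Q : ℤ) * zden * f.bp + zN * mcN T lo hi xc f

/-- `H(c, X_c, z) = Σ σ_k xlnx(β′_k + z m_k)` at `z = zN/zden` as an interval. -/
def hAt (Q T : ℕ) (lo hi : List ℕ) (xc : ℤ) (zden : ℕ) (zN : ℤ) : List KForm → Option MI
  | [] => some (MI.ofInt SC 0)
  | f :: F =>
    match hAt Q T lo hi xc zden zN F, xlnxI (wAt Q T lo hi xc zden zN f) (Q * zden) with
    | some J, some I => some (J.add (I.mulInt f.sg))
    | _, _ => none

/-- The log-form `η = H′(c, X_c, ·)` at `z = zN/zden`: `Σ σ_k m_k log|β′_k + z m_k|`, `m_k = mcN_k/Q`, as an interval. -/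
def etaAt (Q T : ℕ) (lo hi : List ℕ) (xc : ℤ) (zden : ℕ) (zN : ℤ) : List KForm → Option MI
  | [] => some (MI.ofInt SC 0)
  | f :: F =>
    let w := wAt Q T lo hi xc zden zN f
    if w = 0 then none else
    match etaAt Q T lo hi xc zden zN F, lnNat w.natAbs, lnNat (Q * zden) with
    | some J, some Lw, some LQ => some (J.add (((Lw.sub LQ).mulInt (f.sg * mcN T lo hi xc f)).divNat Q))
    | _, _, _ => none

/-- Upper curvature weight of one resolved form: `S/(2·mN)` on the convex side (`σ·w > 0`), `−S/(2·MN)` on the concave side. -/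
def rhoUp (S mN MN : ℚ) (pos : Bool) : ℚ := if pos then S / (2 * mN) else -S / (2 * MN)

/-- Lower curvature weight of one resolved form: `S/(2·MN)` on the convex side, `−S/(2·mN)` on the concave side. -/
def rhoLo (S mN MN : ℚ) (pos : Bool) : ℚ := if pos then S / (2 * MN) else -S / (2 * mN)

/-- The curvature coefficient of `H(c, X_c, ·)` on the z-piece `[za, zb]/zden` from the per-form quadratic bounds:
`λ = Σ_k ρ_k m_k²` with `ρ_k` from the modulus range of `w_k = Q·zden·(β′_k + z m_k)` over the piece (linear in `z`, so
spanned by the endpoints) — `upper = true`: `σ_k·tanD ≤ ρ_k Δ²` (`ρ = 1/(2m̃)` if `σ w > 0`, `−1/(2M̃)` if `σ w < 0`);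
`upper = false`: `σ_k·tanD ≥ ρ_k Δ²` (`ρ = 1/(2M̃)` resp. `−1/(2m̃)`). `none` if a form is not sign-definite. -/
def lamPiece (Q T : ℕ) (lo hi : List ℕ) (xc : ℤ) (zden : ℕ) (za zb : ℤ) (upper : Bool) : List KForm → Option ℚ
  | [] => some 0
  | f :: F =>
    let wa := wAt Q T lo hi xc zden za f
    let wb := wAt Q T lo hi xc zden zb f
    if ¬ (0 < wa * wb ∧ (f.sg = 1 ∨ f.sg = -1)) then none else
    match lamPiece Q T lo hi xc zden za zb upper F with
    | none => none
    | some acc =>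
      let mN : ℚ := min (wa.natAbs : ℚ) (wb.natAbs : ℚ)   -- `Q·zden·m̃`
      let MN : ℚ := max (wa.natAbs : ℚ) (wb.natAbs : ℚ)   -- `Q·zden·M̃`
      let S : ℚ := (Q : ℚ) * zden
      let pos : Bool := decide (0 < f.sg * wa)          -- sign of `σ·w`
      let ρ : ℚ := if upper then rhoUp S mN MN pos else rhoLo S mN MN pos
      let m : ℚ := (mcN T lo hi xc f : ℚ) / Q
      some (acc + ρ * m * m)

/-- A quadratic `A z² + B z + C` is `≥ 0` on `[a, b]`: endpoint values `≥ 0`, and if `A > 0` with the vertex strictly inside,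
the vertex value `≥ 0` (decidable in `ℚ`). -/
def quadNonnegOn (A B C a b : ℚ) : Bool :=
  decide (0 ≤ A * a * a + B * a + C) && decide (0 ≤ A * b * b + B * b + C) &&
    (decide (A ≤ 0) || decide (-B ≤ 2 * A * a) || decide (2 * A * b ≤ -B) || decide (0 ≤ C - B * B / (4 * A)))

/-- The general-piece bound (base point `za ≠ 0`, `zb ≠ 0`): the second-order model `R(z) = h + (z − a)η + λ(z − a)²` of `H`
from the side fixed by `upper` (`H ≤ R`, used for `z < 0`; `H ≥ R`, used for `z > 0`), a candidate `κ` from nine sample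
values of `R(z)/z` minus `10⁻⁵` (shortened to a dyadic), VERIFIED by `quadNonnegOn` (`κz − R(z) ≥ 0` resp. `R(z) − κz ≥ 0`). -/
def kPieceGen (upper : Bool) (Q T : ℕ) (lo hi : List ℕ) (xc : ℤ) (zden : ℕ) (za zb : ℤ) : Option ℚ :=
  match lamPiece Q T lo hi xc zden za zb upper kforms, hAt Q T lo hi xc zden za kforms,
    etaAt Q T lo hi xc zden za kforms with
  | some lam, some HI, some EI =>
    let a : ℚ := (za : ℚ) / zden
    let b : ℚ := (zb : ℚ) / zden
    let h : ℚ := if upper then (HI.hi : ℚ) / SC else (HI.lo : ℚ) / SC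
    let η : ℚ := if upper then (EI.hi : ℚ) / SC else (EI.lo : ℚ) / SC
    let A := lam
    let B := η - 2 * lam * a
    let C := h - η * a + lam * a * a
    let R : ℚ → ℚ := fun z => A * z * z + B * z + C
    let pts : List ℚ := (List.range 9).map fun i => a + (b - a) * (i : ℚ) / 8
    let κ0 : ℚ := ((pts.map fun z => R z / z).foldr min (R a / a)) - 1 / 100000
    let κ : ℚ := (Rat.floor (κ0 * 2 ^ 40) : ℚ) / 2 ^ 40
    let ok : Bool := if upper then quadNonnegOn (-A) (κ - B) (-C) a b else quadNonnegOn A (B - κ) C a b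
    if ok then some κ else none
  | _, _, _ => none

/-- **Lower bound of `K = H/z` on one z-piece** `[za, zb]/zden` (a rational, or `none`). Pieces touching `0` use the base
point `0`, where `H(0) = 0` and `H′(0) = 0`: `K ≥ min(λ·z_end, 0)`. Other pieces: `kPieceGen` with the side by the sign of `z`. -/
def kPieceLo (Q T : ℕ) (lo hi : List ℕ) (xc : ℤ) (zden : ℕ) (za zb : ℤ) : Option ℚ :=
  if za = 0 then
    match lamPiece Q T lo hi xc zden za zb false kforms with
    | some lam => some (min (lam * ((zb : ℚ) / zden)) 0)
    | none => none
  else if zb = 0 then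
    match lamPiece Q T lo hi xc zden za zb true kforms with
    | some lam => some (min (lam * ((za : ℚ) / zden)) 0)
    | none => none
  else if zb < 0 then kPieceGen true Q T lo hi xc zden za zb
  else kPieceGen false Q T lo hi xc zden za zb

/-- The minimum of the piece bounds over a list of pieces. -/
def kMin (Q T : ℕ) (lo hi : List ℕ) (xc : ℤ) (zden : ℕ) : List (ℤ × ℤ) → Option ℚ
  | [] => none
  | [p] => kPieceLo Q T lo hi xc zden p.1 p.2
  | p :: ps =>
    match kPieceLo Q T lo hi xc zden p.1 p.2, kMin Q T lo hi xc zden ps with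
    | some a, some b => some (min a b)
    | _, _ => none

/-- `A_c(X_c) = Σ σ_k xlnx(L_k(c, X_c))` over the thirteen `Y`-free forms, as an interval
(`Q·L_k(c, X_c) = T(minNum + maxNum) + β·xc`). -/
def aCentre (Q T : ℕ) (lo hi : List ℕ) (xc : ℤ) : List EForm → Option MI
  | [] => some (MI.ofInt SC 0)
  | f :: F =>
    match aCentre Q T lo hi xc F, xlnxI ((T : ℤ) * (minNum f.al lo hi + maxNum f.al lo hi) + f.bx * xc) Q with
    | some J, some I => some (J.add (I.mulInt f.sg))
    | _, _ => none

/-! ### Concavity in `X` on (X-sub-piece × z-piece) cells -/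

/-- The `X`-range `[Xlo, Xhi]` (scale `Q`, rounded outward) of the far point `X = xNum/xDen` on the z-piece `[za, zb]/zden`
over the box, by g38's `xhatAF` on the piece's affine coordinate. -/
def xRange (D T : ℕ) (lo hi : List ℕ) (zden : ℕ) (za zb : ℤ) : Option (ℤ × ℤ) :=
  (xhatAF (tAF D lo hi) (coordAF (za + zb) [0, 0, 0, 0, 0, 0, 0] (zb - za).toNat 9 (2 * zden))).map fun XA =>
    ((AForm.lo XA * (2 * D * T : ℕ)) / (SC : ℤ), -((-(AForm.hi XA) * (2 * D * T : ℕ)) / (SC : ℤ)))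

/-- An optional rational bound: `none` = unbounded. -/
abbrev OQ := Option ℚ

/-- The curvature weight of ONE form on a cell, or `none` if its sign is not certified. The cell: box, `X ∈ [xa, xb]/(Q·M)`,
`Y = 1/z` with `Ylo ≤ Y ≤ Yhi` (optional ends). `X`-only forms: exact integer range `[A, B]` at scale `Q·M`; the two mixed
forms (`β = β′ = 1`): ranges `[l, u]` in `ℚ` with possibly infinite ends. Rule (one strict sign of `L` on the cell required):
`σ = 1 ↦ ρ = 1/(2·Lmin)`, `σ = −1 ↦ ρ = −1/(2·Lmax)` — this is `1/(2m)` on the convex side and `−1/(2M)` on the concave side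
in either sign case (`0` when the relevant end is infinite); forms with `β = 0` contribute `0`. -/
def cellRho (D T M : ℕ) (lo hi : List ℕ) (xa xb : ℤ) (Ylo Yhi : OQ) (f : EForm) : Option ℚ :=
  if f.bx = 0 then some 0 else
  if ¬ (f.sg = 1 ∨ f.sg = -1) then none else
  let QM : ℚ := 2 * (D : ℚ) * T * M
  if f.bY = 0 then
    let A : ℤ := 2 * (T : ℤ) * M * minNum f.al lo hi + min (f.bx * xa) (f.bx * xb)
    let B : ℤ := 2 * (T : ℤ) * M * maxNum f.al lo hi + max (f.bx * xa) (f.bx * xb)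
    -- uniform rule (valid for either strict sign of `L` on the cell): `σ = 1 ↦ Q·M/(2A)`, `σ = −1 ↦ −Q·M/(2B)`
    if 0 < A ∨ B < 0 then (if f.sg = 1 then some (QM / (2 * A)) else some (-QM / (2 * B))) else none
  else if ¬ (f.bx = 1 ∧ f.bY = 1) then none else
    let A : ℚ := ((2 * (T : ℤ) * M * minNum f.al lo hi + min xa xb : ℤ) : ℚ) / QM
    let B : ℚ := ((2 * (T : ℤ) * M * maxNum f.al lo hi + max xa xb : ℤ) : ℚ) / QM
    match Ylo.map (A + ·), Yhi.map (B + ·) with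
    | some l, some u =>
      if 0 < l then (if f.sg = 1 then some (1 / (2 * l)) else some (-1 / (2 * u)))
      else if u < 0 then (if f.sg = 1 then some (1 / (2 * l)) else some (-1 / (2 * u)))
      else none
    | some l, none => if 0 < l then (if f.sg = 1 then some (1 / (2 * l)) else some 0) else none
    | none, some u => if u < 0 then (if f.sg = 1 then some 0 else some (-1 / (2 * u))) else none
    | none, none => none

/-- Sum of the curvature weights over a form list on one cell (`none` if any form fails). -/
def cellSum (D T M : ℕ) (lo hi : List ℕ) (xa xb : ℤ) (Ylo Yhi : OQ) : List EForm → Option ℚ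
  | [] => some 0
  | f :: F =>
    match cellSum D T M lo hi xa xb Ylo Yhi F, cellRho D T M lo hi xa xb Ylo Yhi f with
    | some s, some r => some (s + r * f.bx * f.bx)
    | _, _ => none

/-- The cell test: the curvature form of the 21 forms is `≤ 0` on the cell. -/
def concCell (D T M : ℕ) (lo hi : List ℕ) (xa xb : ℤ) (Ylo Yhi : OQ) : Bool :=
  match cellSum D T M lo hi xa xb Ylo Yhi vforms with
  | some s => decide (s ≤ 0)
  | none => false

/-- The `Y = 1/z` range of a z-piece `[za, zb]/zden` not straddling `0`: `[zden/zb, zden/za]` with an infinite end where an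
endpoint is `0`. -/
def yRange (zden : ℕ) (za zb : ℤ) : OQ × OQ :=
  (if zb = 0 then none else some ((zden : ℚ) / zb), if za = 0 then none else some ((zden : ℚ) / za))

/-- All `M` sub-cells of the X-interval `[Ilo, Ihi]/Q` (breakpoints `(Ilo·M + k·(Ihi − Ilo))/(Q·M)`) pass `concCell`. -/
def concPiece (D T M : ℕ) (lo hi : List ℕ) (Ilo Ihi : ℤ) (Ylo Yhi : OQ) : Bool :=
  (List.range M).all fun k =>
    concCell D T M lo hi (Ilo * M + (k : ℤ) * (Ihi - Ilo)) (Ilo * M + ((k : ℤ) + 1) * (Ihi - Ilo)) Ylo Yhi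

/-- The per-z-piece test given the far point's `X`-range `[Xlo, Xhi]/Q` on the piece: `x = X + t₆ < 0` there, and
concavity holds on `[min(X_c, Xlo), max(X_c, Xhi)] ×` piece in `xsub` sub-cells. -/
def pieceCheckX (D T : ℕ) (lo hi : List ℕ) (sd : SliceData) (zden : ℕ) (za zb Xlo Xhi : ℤ) : Bool :=
  decide (Xhi * (D : ℤ) + ((hi.getD 6 0 : ℕ) : ℤ) * (2 * D * T : ℕ) < 0) && decide (0 < sd.xsub) &&
    concPiece D T sd.xsub lo hi (min sd.xc Xlo) (max sd.xc Xhi) (yRange zden za zb).1 (yRange zden za zb).2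

/-- The per-z-piece test: the far point's `X`-range on the piece exists and `pieceCheckX` passes. -/
def pieceCheck (D T : ℕ) (lo hi : List ℕ) (sd : SliceData) (zden : ℕ) (za zb : ℤ) : Bool :=
  (xRange D T lo hi zden za zb).elim false fun p => pieceCheckX D T lo hi sd zden za zb p.1 p.2

/-! ### The assembled check -/

/-- The hull `hull_A + hull_K` of the centre slice (8 intervals at scale `SC`), if both accumulators succeed. -/
def sliceHull (D T : ℕ) (lo hi : List ℕ) (fd : FarData) (sd : SliceData) : Option (List MI) :=
  match aHull D T lo hi sd.xc, kAcc (2 * D * T) T lo hi sd.xc fd.zden fd.zlo fd.zhi kforms with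
  | some gA, some gK => some (addHulls gA gK)
  | _, _ => none

/-- The final arithmetic: `c0num/den ≤ A.lo/SC + kmin` (both present). -/
def finalCheck (sd : SliceData) : Option ℚ → Option MI → Bool
  | some km, some AI => decide ((sd.c0num : ℚ) / sd.den ≤ (AI.lo : ℚ) / SC + km)
  | _, _ => false

/-- **THE CENTRE-SLICE CHECK.** Well-formedness (`boxOKc`, `T > 0` even, `zden > 0`, breakpoints increasing inside
`(zlo, zhi)` with no piece straddling `0`, `|z| < 1` on `Z`, `den > 0`), the two hulls exist, every z-piece passes
`pieceCheck` (X-range, `x < 0`, concavity cells), `K_c(X_c, ·) ≥ kmin` on every piece and `A_c(X_c) ≥ alo`, and the claimed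
constant `c0num/den ≤ alo + kmin`. -/
def farSliceCheck (D T : ℕ) (lo hi : List ℕ) (fd : FarData) (sd : SliceData) : Bool :=
  boxOKc D lo hi && decide (0 < T / 2) && decide (T % 2 = 0) && decide (0 < fd.zden) && decide (0 < sd.den) &&
    zListOK (zList fd sd) && decide (zAbsMax fd < fd.zden) && decide (fd.zlo ≠ 0) && decide (fd.zhi ≠ 0) &&
    (sliceHull D T lo hi fd sd).isSome &&
    (pairs (zList fd sd)).all (fun p => pieceCheck D T lo hi sd fd.zden p.1 p.2) &&
    finalCheck sd (kMin (2 * D * T) T lo hi sd.xc fd.zden (pairs (zList fd sd))) (aCentre (2 * D * T) T lo hi sd.xc aforms)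

/-- Report (for preparing certificate data with `#eval`): the interval of `A_c(X_c)`, the minimum of `K` over the pieces,
and the per-piece `X`-ranges / concavity flags. Not used in any theorem. -/
def sliceReport (D T : ℕ) (lo hi : List ℕ) (fd : FarData) (sd : SliceData) :
    Option MI × Option ℚ × Option (List MI) × List (ℤ × ℤ × Option (ℤ × ℤ) × Bool) :=
  let Q := 2 * D * T
  (aCentre Q T lo hi sd.xc aforms, kMin Q T lo hi sd.xc fd.zden (pairs (zList fd sd)), sliceHull D T lo hi fd sd,
    (pairs (zList fd sd)).map fun p => (p.1, p.2, xRange D T lo hi fd.zden p.1 p.2, pieceCheck D T lo hi sd fd.zden p.1 p.2))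

end FarSlice

end Summit.KontsevichZagierPeriods.Zeta5Search.Barrier.ConeGamma
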